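import Summits.Ventures.Crystal3D.Theorems.StickyWulffConstantGenericWallFloorAtOfLedger
import Summits.Ventures.Crystal3D.Theorems.StickyWulffConstantGenericWallFloorStackWalkWordSepTwo
import HarnessLib

/-!
# The localised stack ledger and `GenericWallFloor` per pair under the LEVEL-TWO word criterion
# (crux `GenericWallFloor`, line `WallLedgerG`; forced-chain localisation, third assembly)

HONEST FRAMING. Part of the venture `Summits/Ventures/Crystal3D` (cell `crystal3d-full`), helper `--supports` the
crux `GenericWallFloor` (stmt-Ventures-19480) of `route-Ventures-StickyWulffConstant`, registered line `WallLedgerG`,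
open stub `stub_twoSlabAdhesion` (general fillings).  Instantiates the separated-frame-set core
`twoSlabAdhesion_stackLedger_local_sep` with the minimal frame sets and the separation lemma `not_coaxial_of_word_two`
(`…StackWalkWordSepTwo`): chain pairs at twin distance `≥ 3` (`A₂·Λ₀ = (wordFrame A₁ (κ₀ ++ [μ₂, μ₁]))·Λ₀`, `κ₀ ≠ []`,
word reduced), `u₂` in the last mirror plane, and the near forced ray allowed ONE step along the connecting path: if the
first push normal is `±A₁μ₁`, the best capper's forced second normal is not `±μ₂` (cells `(l,c) ∈ {(0,0),(1,0)}` of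
ROUTE.md §84 R41t).  Inputs BY NAME: `ExactOnly`(C12-55) [E1] and `StarPairCoaxial` [certified as `StarPairFar`].

* `twoSlabAdhesion_stackLedger_local_wordTwo_star` — the stub's inequality at FULL charge, no residual;
* `genericWallFloorAt_wordTwo_of_star` — `GenericWallFloor`'s conclusion VERBATIM for the pair.

WHAT THIS IS NOT: not the stub — `(l,c) = (0,1)` and the ray-aligned core `l + c ≥ k − 1` remain; F-C1 not moved.
-/

noncomputable section

namespace Summit.Ventures.Crystal3D.Theorems

open Summit.Ventures.Crystal3D Finset
open Literature.MathematicalPhysics.StatisticalMechanics (fccStacking barlowStacking IsHaggSeq contactDeficiency)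
open scoped InnerProductSpace

open scoped Classical in
/-- **The localised stack ledger under the level-two word criterion (full charge, no residual), two inputs.**  See the
module docstring. -/
theorem twoSlabAdhesion_stackLedger_local_wordTwo_star
    {s₀ : EuclideanSpace ℝ (Fin 3)} (hs₀ : s₀ ∈ fccSlots)
    (hcert : ExactOnly 0 (fccSlots.filter fun w => 0 < ⟪w, s₀⟫_ℝ))
    (hSP : StarPairCoaxial)
    (A₁ : EuclideanSpace ℝ (Fin 3) ≃ₗᵢ[ℝ] EuclideanSpace ℝ (Fin 3)) (t₁ : EuclideanSpace ℝ (Fin 3))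
    (A₂ : EuclideanSpace ℝ (Fin 3) ≃ₗᵢ[ℝ] EuclideanSpace ℝ (Fin 3)) (t₂ : EuclideanSpace ℝ (Fin 3))
    {u₁ : EuclideanSpace ℝ (Fin 3)} (hu₁ : u₁ ∈ fccSlots)
    (hsteep₁ : Real.sqrt 2 / 2 ≤ ⟪A₁ u₁, EuclideanSpace.single (2 : Fin 3) (1 : ℝ)⟫_ℝ)
    {u₂ : EuclideanSpace ℝ (Fin 3)} (hu₂ : u₂ ∈ fccSlots)
    (hsteep₂ : ⟪A₂ u₂, EuclideanSpace.single (2 : Fin 3) (1 : ℝ)⟫_ℝ ≤ -(Real.sqrt 2 / 2))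
    (κ₀ : List (EuclideanSpace ℝ (Fin 3))) (μ₂ μ₁ : EuclideanSpace ℝ (Fin 3)) (hκ₀ : κ₀ ≠ [])
    (hκl : ∀ μ ∈ κ₀ ++ [μ₂, μ₁], ‖μ‖ = 1 ∧
      ∀ w ∈ fccSlots, ⟪w, μ⟫_ℝ = 0 ∨ ⟪w, μ⟫_ℝ = Real.sqrt (2 / 3) ∨ ⟪w, μ⟫_ℝ = -Real.sqrt (2 / 3))
    (hκc : List.IsChain (fun μ μ' => ⟪μ, μ'⟫_ℝ = 1 / 3 ∨ ⟪μ, μ'⟫_ℝ = -1 / 3) (κ₀ ++ [μ₂, μ₁]))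
    (hA₂ : A₂ '' fccStacking 1 (Real.sqrt (2 / 3)) = (wordFrame A₁ (κ₀ ++ [μ₂, μ₁])) '' fccStacking 1 (Real.sqrt (2 / 3)))
    (hsecond : ∀ n₁ : EuclideanSpace ℝ (Fin 3), (n₁ = A₁ μ₁ ∨ n₁ = -A₁ μ₁) → ⟪A₁ u₁, n₁⟫_ℝ = Real.sqrt (2 / 3) →
      ∀ q ∈ fccSlots, 0 < ⟪twinFrame A₁ n₁ q, n₁⟫_ℝ →
        (∀ q' ∈ fccSlots, 0 < ⟪twinFrame A₁ n₁ q', n₁⟫_ℝ →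
          ⟪twinFrame A₁ n₁ q', EuclideanSpace.single (2 : Fin 3) (1 : ℝ)⟫_ℝ ≤
            ⟪twinFrame A₁ n₁ q, EuclideanSpace.single (2 : Fin 3) (1 : ℝ)⟫_ℝ) →
        (twinFrame A₁ n₁).symm ((2 * Real.sqrt (2 / 3)) • twinFrame A₁ n₁ q - n₁) ≠ μ₂ ∧
        (twinFrame A₁ n₁).symm ((2 * Real.sqrt (2 / 3)) • twinFrame A₁ n₁ q - n₁) ≠ -μ₂)
    (hlast : ∀ μ, (κ₀ ++ [μ₂, μ₁]).head? = some μ → ⟪A₂ u₂, wordFrame A₁ (κ₀ ++ [μ₂, μ₁]) μ⟫_ℝ = 0) :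
    ∃ C R₀ : ℝ, 1 ≤ R₀ ∧ ∀ h : ℝ, 0 ≤ h → ∀ ρ : ℝ, R₀ ≤ ρ →
      ∀ X P₁ P₂ : Finset (EuclideanSpace ℝ (Fin 3)),
      (∀ p ∈ X, ∀ q ∈ X, p ≠ q → 1 ≤ dist p q) → P₁ ⊆ X → P₂ ⊆ X \ P₁ →
      (∀ p ∈ X, -(2 * R₀) ≤ p 2 ∧ p 2 ≤ h + 2 * R₀ ∧ p 0 ^ 2 + p 1 ^ 2 ≤ ρ ^ 2) →
      (∀ p, p ∈ P₁ ↔ (p ∈ (fun q => A₁ q + t₁) '' fccStacking 1 (Real.sqrt (2 / 3)) ∧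
        -(2 * R₀) ≤ p 2 ∧ p 2 ≤ -R₀ ∧ p 0 ^ 2 + p 1 ^ 2 ≤ ρ ^ 2)) →
      (∀ p, p ∈ P₂ ↔ (p ∈ (fun q => A₂ q + t₂) '' fccStacking 1 (Real.sqrt (2 / 3)) ∧
        h + R₀ ≤ p 2 ∧ p 2 ≤ h + 2 * R₀ ∧ p 0 ^ 2 + p 1 ^ 2 ≤ ρ ^ 2)) →
      ((((P₁ ×ˢ (X \ P₁)).filter fun pq => dist pq.1 pq.2 = 1).card : ℕ) : ℝ) +
        ((((P₂ ×ˢ ((X \ P₁) \ P₂)).filter fun pq => dist pq.1 pq.2 = 1).card : ℕ) : ℝ) ≤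
        contactDeficiency ((X \ P₁) \ P₂) +
          (Real.sqrt 2 / 4 * ∑ᶠ w ∈ {w ∈ fccStacking 1 (Real.sqrt (2 / 3)) | ‖w‖ = 1},
              |⟪w, A₁.symm (EuclideanSpace.single (2 : Fin 3) (1 : ℝ))⟫_ℝ| +
            Real.sqrt 2 / 4 * ∑ᶠ w ∈ {w ∈ fccStacking 1 (Real.sqrt (2 / 3)) | ‖w‖ = 1},
              |⟪w, A₂.symm (EuclideanSpace.single (2 : Fin 3) (1 : ℝ))⟫_ℝ| -
            (Real.sqrt 2 * |⟪A₁ u₁, EuclideanSpace.single (2 : Fin 3) (1 : ℝ)⟫_ℝ| +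
              Real.sqrt 2 * |⟪A₂ u₂, EuclideanSpace.single (2 : Fin 3) (1 : ℝ)⟫_ℝ|) / 2) * Real.pi * ρ ^ 2 +
          C * (1 + h) * ρ :=
  twoSlabAdhesion_stackLedger_local_sep hs₀ hcert (doubleStarCoaxialAt_of_starPair hSP) (capPairCoaxial_of_starPair hSP)
    A₁ t₁ A₂ t₂ hu₁ hsteep₁ hu₂ hsteep₂
    {F | ∃ stk : List WalkEntry, StackSound (EuclideanSpace.single (2 : Fin 3) (1 : ℝ)) stk ∧
      StackWF (EuclideanSpace.single (2 : Fin 3) (1 : ℝ)) stk ∧ stk.getLast? = some ⟨A₁, u₁, 0⟩ ∧ ∃ e ∈ stk, e.frame = F}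
    {F | ∃ stk : List WalkEntry, StackSound (-EuclideanSpace.single (2 : Fin 3) (1 : ℝ)) stk ∧
      StackWF (-EuclideanSpace.single (2 : Fin 3) (1 : ℝ)) stk ∧ stk.getLast? = some ⟨A₂, u₂, 0⟩ ∧ ∃ e ∈ stk, e.frame = F}
    (fun stk hS hW hlast e he => ⟨stk, hS, hW, hlast, e, he, rfl⟩)
    (fun stk hS hW hlast e he => ⟨stk, hS, hW, hlast, e, he, rfl⟩)
    (fun _ ⟨_, hS₁, hW₁, hl₁, _, he₁, hF₁⟩ _ ⟨_, hS₂, hW₂, hl₂, _, he₂, hF₂⟩ => by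
      rw [← hF₁, ← hF₂]
      exact not_coaxial_of_word_two κ₀ μ₂ μ₁ hκ₀ hκl hκc hA₂ hsecond hlast hS₁ hW₁ hl₁ hS₂ hW₂ hl₂ he₁ he₂)

open scoped Classical in
/-- **`GenericWallFloor` for every chain pair under the level-two word criterion**, modulo `ExactOnly`(C12-55) and
`StarPairCoaxial`. -/
theorem genericWallFloorAt_wordTwo_of_star
    {s₀ : EuclideanSpace ℝ (Fin 3)} (hs₀ : s₀ ∈ fccSlots)
    (hcert : ExactOnly 0 (fccSlots.filter fun w => 0 < ⟪w, s₀⟫_ℝ))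
    (hSP : StarPairCoaxial)
    (A₁ : EuclideanSpace ℝ (Fin 3) ≃ₗᵢ[ℝ] EuclideanSpace ℝ (Fin 3)) (t₁ : EuclideanSpace ℝ (Fin 3))
    (A₂ : EuclideanSpace ℝ (Fin 3) ≃ₗᵢ[ℝ] EuclideanSpace ℝ (Fin 3)) (t₂ : EuclideanSpace ℝ (Fin 3))
    {u₁ : EuclideanSpace ℝ (Fin 3)} (hu₁ : u₁ ∈ fccSlots)
    (hsteep₁ : Real.sqrt 2 / 2 ≤ ⟪A₁ u₁, EuclideanSpace.single (2 : Fin 3) (1 : ℝ)⟫_ℝ)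
    {u₂ : EuclideanSpace ℝ (Fin 3)} (hu₂ : u₂ ∈ fccSlots)
    (hsteep₂ : ⟪A₂ u₂, EuclideanSpace.single (2 : Fin 3) (1 : ℝ)⟫_ℝ ≤ -(Real.sqrt 2 / 2))
    (κ₀ : List (EuclideanSpace ℝ (Fin 3))) (μ₂ μ₁ : EuclideanSpace ℝ (Fin 3)) (hκ₀ : κ₀ ≠ [])
    (hκl : ∀ μ ∈ κ₀ ++ [μ₂, μ₁], ‖μ‖ = 1 ∧
      ∀ w ∈ fccSlots, ⟪w, μ⟫_ℝ = 0 ∨ ⟪w, μ⟫_ℝ = Real.sqrt (2 / 3) ∨ ⟪w, μ⟫_ℝ = -Real.sqrt (2 / 3))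
    (hκc : List.IsChain (fun μ μ' => ⟪μ, μ'⟫_ℝ = 1 / 3 ∨ ⟪μ, μ'⟫_ℝ = -1 / 3) (κ₀ ++ [μ₂, μ₁]))
    (hA₂ : A₂ '' fccStacking 1 (Real.sqrt (2 / 3)) = (wordFrame A₁ (κ₀ ++ [μ₂, μ₁])) '' fccStacking 1 (Real.sqrt (2 / 3)))
    (hsecond : ∀ n₁ : EuclideanSpace ℝ (Fin 3), (n₁ = A₁ μ₁ ∨ n₁ = -A₁ μ₁) → ⟪A₁ u₁, n₁⟫_ℝ = Real.sqrt (2 / 3) →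
      ∀ q ∈ fccSlots, 0 < ⟪twinFrame A₁ n₁ q, n₁⟫_ℝ →
        (∀ q' ∈ fccSlots, 0 < ⟪twinFrame A₁ n₁ q', n₁⟫_ℝ →
          ⟪twinFrame A₁ n₁ q', EuclideanSpace.single (2 : Fin 3) (1 : ℝ)⟫_ℝ ≤
            ⟪twinFrame A₁ n₁ q, EuclideanSpace.single (2 : Fin 3) (1 : ℝ)⟫_ℝ) →
        (twinFrame A₁ n₁).symm ((2 * Real.sqrt (2 / 3)) • twinFrame A₁ n₁ q - n₁) ≠ μ₂ ∧
        (twinFrame A₁ n₁).symm ((2 * Real.sqrt (2 / 3)) • twinFrame A₁ n₁ q - n₁) ≠ -μ₂)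
    (hlast : ∀ μ, (κ₀ ++ [μ₂, μ₁]).head? = some μ → ⟪A₂ u₂, wordFrame A₁ (κ₀ ++ [μ₂, μ₁]) μ⟫_ℝ = 0) :
    GenericWallFloorAt A₁ t₁ A₂ t₂ :=
  genericWallFloorAt_of_ledger A₁ t₁ A₂ t₂ hsteep₁ hsteep₂
    (twoSlabAdhesion_stackLedger_local_wordTwo_star hs₀ hcert hSP A₁ t₁ A₂ t₂ hu₁ hsteep₁ hu₂ hsteep₂ κ₀ μ₂ μ₁ hκ₀ hκl hκc
      hA₂ hsecond hlast)

end Summit.Ventures.Crystal3D.Theorems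

end
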